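/-
Copyright: b2b-lace packet (carver, gen 53).  [FvdH17] App. B / §6.1 with §4.2 and [NoBLE17] (5.40): node N76-EXL of the packet — the
entries `P^{E}_1`, `P^{S}_1`, `A_{0,1}`, `(Ā^{ι}')_{0,0}`, `(Ā^{ι,*}')_{0,0}` of `Letters.perc` priced by PEELING their exact unit leg
(`NoblePeelExactLeg`), and the peel at the third position.  Proofs only; no named fact; no numeral; no dimension.
-/
import Literature.Probability.FitznerVanDerHofstad2017.NoblePeelExactLeg
import Literature.Probability.FitznerVanDerHofstad2017.NobleBubbleLetterSums
import HarnessLib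

/-!
# Fitzner–van der Hofstad (2017), App. B / §6.1 — entries with one exact unit leg, by the peel

[FvdH17] = R. Fitzner, R. van der Hofstad, *Mean-field behavior for nearest-neighbor percolation in `d > 10`*,
Electron. J. Probab. **22** (2017), no. 43, arXiv:1506.07977v2; [NoBLE17] = the same authors, *Generalized approach
to the non-backtracking lace expansion*, Probab. Theory Relat. Fields **169** (2017) 1041–1119, arXiv:1506.07969.

§ Peel at the third position.  `genDisjOcc_lineEvents₃_eqOne₃_subset`, `perc_T_eqOne₃_eq_zero`,
`perc_T_eqOne₃_le_p_mul_B`: `𝓣_{j₁,j₂,1̲}(x,y,v) ≤ p · 𝓑_{j₁,j₂}(x,y)` (the exact CLOSING leg; companion of the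
first- and middle-position peels of `NoblePeelExactLeg`; device for the small triangles `𝓣_{1,1,1̲}(·,·,0)` of the
`B^{(2),ι}` table, App. B p. 77), node form `perc_T_ge_ge_eqOne_le_p_mul_B`.

§ `P^{E}_1`, `P^{S}_1`, `A_{0,1}`.  `P^{E}_1 = Σ_{x,y ≠ 0} 𝓣_{1,1̲,1}(x,y,0)`, `P^{S}_1 = Σ_{x ≠ 0} 𝓑_{3,1̲}(x,0) + P^{E}_1`
(App. B Table "definition of `P^b(x,y)`", row `b = 1`, v2 p. 73; `vecPE_one`, `vecPS_one`) and
`A_{0,1} = Σ_x Σ_{y ≠ 0} 𝓣_{1,1̲,1}(x,y,0)` (p. 74; `matA_zero_one`).  Peeling the exact middle leg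
(`perc_T_eqOne₂_le_p_mul_B`: factor `p`, the two outer lines re-rooted at `y` form the bubble `𝓑_{1,1}(−y, x−y)` with
unit endpoint `x − y`) and pricing each of the `2d` unit-endpoint bubble slots by [NoBLE17] (5.40)
(`tsum_kdc_perc_B_ge_le_ofReal`) gives

* `perc_tsum_tsum_kdc_T_ge_eqOne_ge_le_peel`: `Σ_x Σ_{y ≠ 0} 𝓣_{1,1̲,1}(x,y,0) ≤ 2d · p · bubbleSlotR p Γ̄₂ 1 1 M N R₁ R₂`
  (unit-class trail counts `N` and remainder-kernel constants `R₁`, `R₂`), whence `perc_vecPE_one_le_peel` and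
  `perc_matA_zero_one_le_peel` with the same right-hand side;
* `perc_tsum_kdc_B_ge_eqOne_le(_ofReal)`: the loop term peels LOSSLESSLY, `Σ_{x ≠ 0} 𝓑_{m,1̲}(x,0) ≤ p · Σ_ι τ_{≥m}(e_ι)
  ≤ 2d · p · T` for `τ_{≥m}(e₁) ≤ T` (`perc_B_eqOne₂_le_p_mul_tau`, `tauGe_stepVec`);
* `perc_vecPS_one_le_ofReal_of_vecPE`: `P^{S}_1 ≤ 2d·p·T3 + W` from ANY real majorant `W ≥ 0` of `P^{E}_1` (the
  consumer shape `vecPS … 1 ≤ ofReal (uR 1)` of the packet's component-majorant interface; tier-independent);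
* `perc_vecPS_one_le_peel`, `perc_vecPS_one_le_peel_ofReal`:  `P^{S}_1 ≤ p · Σ_ι τ_{≥3}(e_ι) + 2d·p·slot`, resp.
  `≤ 2d·p·(T3 + slot)`.

§ The primed row `(0,0)`.  `(Ā^{ι}')_{0,0} = (Ā^{ι,*}')_{0,0} = Σ_x Σ_κ (1−δ_{0,x})(1−δ_{x,e_κ}) 𝓣_{1̲,1,1}(e_κ,x,0)`
(§6.1 Case `a = b = 0`, p. 59; `matAbarIota'_zero_zero`, `matAbarIotaSt'_zero_zero` — the elements the `N ≥ 1`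
chain carries).  Peeling the exact FIRST leg (`perc_T_eqOne₁_le_p_mul_B`: bubble `𝓑_{1,1}(x − e_κ, −e_κ)` re-rooted
at `e_κ`, unit endpoint `−e_κ`) and the same slots give `perc_tsum_sum_kdc_T_eqOne_ge_ge_stepVec_le_peel`,
`perc_matAbarIota'_zero_zero_le_peel`, `perc_matAbarIotaSt'_zero_zero_le_peel`, again with the right-hand side
`2d · p · bubbleSlotR p Γ̄₂ 1 1 M N R₁ R₂`.

These are VALID upper bounds for every `d ≥ 2`, `p < p_c(d)`: the packet's "tier P" prices of these cells (the
published notebook prices them by the exact extraction `Bound[Bubble,3]`, which is smaller; whether a tier-P price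
fits the published budget is for the packet's numerics engines to say, cell by cell).  Nothing landed is modified;
no cited hypothesis; no numeral of record.
-/

noncomputable section

namespace Literature.Probability.FitznerVanDerHofstad2017.NobleBlocks

open _root_.MeasureTheory Finset
open scoped BigOperators ENNReal
open Literature.Probability.LatticeModels Literature.Probability.Percolation
open Literature.Probability.FitznerVanDerHofstad2017
open Literature.Probability.FitznerVanDerHofstad2017.NobleBlocks.LenIdx
open Literature.Barriers.CriticalPhenomena

variable {d : ℕ}

/-! ## `P^{E}_1`, `P^{S}_1`, `A_{0,1}` in tier P (peel at the middle position + unit-endpoint slots) -/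

section EntryOne

variable (p : unitInterval)

/-- Support of the exact-middle-leg triangle summand: off the `2d` translates `x = y + u`, `|u| = 1`, it vanishes
(`𝓣_{j₁,1̲,j₃}(x,y,0) = 0` unless `y − x` is a unit vector). [cite: FitznerVanDerHofstad2017, §4.2 (4.17) (arXiv:1506.07977v2 p. 36)] -/
theorem perc_T_eqOne₂_eq_zero_of_not_mem_image (j₁ j₃ : LenIdx) (y : Site d) {x : Site d}
    (hx : x ∉ (unitVecs d).image (fun u => y + u)) : (Letters.perc d p).T j₁ (.eq 1) j₃ x y 0 = 0 := by
  apply perc_T_eqOne₂_eq_zero p j₁ j₃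
  intro h
  exact hx (Finset.mem_image.2 ⟨x - y, neg_sub y x ▸ neg_mem_unitVecs h, add_sub_cancel y x⟩)

/-- **The (V).1 letter sum by the peel.**  `Σ_{x} Σ_{y ≠ 0} 𝓣_{1,1̲,1}(x,y,0) ≤ 2d · p · slot`: peel the exact
middle leg (`perc_T_eqOne₂_le_p_mul_B`), re-index by the unit step `x − y = e_ι` (`2d` values) and the bubble root
`w = −y`, and price each unit-endpoint repulsive bubble slot `Σ_{w ≠ 0} 𝓑_{1,1}(w, e_ι)` by [NoBLE17] (5.40)
(`tsum_kdc_perc_B_ge_le_ofReal`).  This single estimate serves `P^{E}_1` (`vecPE_one`) and `A_{0,1}` (`matA_zero_one`).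
[cite: FitznerVanDerHofstad2017, App. B Tables "P^b" row b = 1, "A^{a,b}" row (0,1) (arXiv:1506.07977v2 pp. 73–74); §4.2 (4.16)–(4.17) (p. 36); §6.1 after (6.4) (p. 58)] [cite: FitznerVanDerHofstad2016NoBLE, §5.2 (5.40) (arXiv:1506.07969)] -/
theorem perc_tsum_tsum_kdc_T_ge_eqOne_ge_le_peel (hd : 2 ≤ d) (hp : p < criticalProbI d) {M : ℕ} (hM : 1 ≤ M)
    {N : ℕ → ℕ} (hN : ∀ L (ι : Fin d × Bool), (trailWordsTo d L (stepVec ι : Site d)).card ≤ N L) {R₁ R₂ : ℝ}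
    (hR₁ : IsRemKernelConst d [M] (Set.range fun ι : Fin d × Bool => (stepVec ι : Site d)) R₁)
    (hR₂ : IsRemKernelConst d [M - 1, 1] (Set.range fun ι : Fin d × Bool => (stepVec ι : Site d)) R₂) :
    ∑' x, ∑' y, kdc y 0 * (Letters.perc d p).T (.ge 1) (.eq 1) (.ge 1) x y 0 ≤
      ENNReal.ofReal (((2 * d : ℕ) : ℝ) * (p : ℝ) * bubbleSlotR p (nobleSup2 d p) 1 1 M N R₁ R₂) := by
  classical
  set L := Letters.perc d p with hL
  -- each unit-endpoint bubble slot, re-indexed by `w = -y`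
  have hslot : ∀ ι : Fin d × Bool,
      ∑' y, kdc y 0 * L.B (.ge 1) (.ge 1) (-y) (stepVec ι) ≤
        ENNReal.ofReal (bubbleSlotR p (nobleSup2 d p) 1 1 M N R₁ R₂) := by
    intro ι
    have hre : ∑' y, kdc y 0 * L.B (.ge 1) (.ge 1) (-y) (stepVec ι) =
        ∑' w, kdc w 0 * L.B (.ge 1) (.ge 1) w (stepVec ι) := by
      rw [← (Equiv.neg (Site d)).tsum_eq (fun w => kdc w 0 * L.B (.ge 1) (.ge 1) w (stepVec ι))]
      refine tsum_congr fun y => ?_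
      simp [kdc, neg_eq_zero]
    rw [hre]
    exact tsum_kdc_perc_B_ge_le_ofReal hd p hp hM (Set.mem_range_self ι) (hN · ι) hR₁ hR₂
  -- the summand and its support
  have hterm : ∀ x y, kdc y 0 * L.T (.ge 1) (.eq 1) (.ge 1) x y 0 ≤
      kdc y 0 * (ENNReal.ofReal p * L.B (.ge 1) (.ge 1) (-y) (x - y)) := by
    intro x y
    gcongr
    exact perc_T_eqOne₂_le_p_mul_B p (.ge 1) (.ge 1) x y
  calc ∑' x, ∑' y, kdc y 0 * L.T (.ge 1) (.eq 1) (.ge 1) x y 0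
      = ∑' y, ∑' x, kdc y 0 * L.T (.ge 1) (.eq 1) (.ge 1) x y 0 := ENNReal.tsum_comm
    _ = ∑' y, ∑ x ∈ (unitVecs d).image (fun u => y + u), kdc y 0 * L.T (.ge 1) (.eq 1) (.ge 1) x y 0 := by
        refine tsum_congr fun y => tsum_eq_sum fun x hx => ?_
        rw [hL, perc_T_eqOne₂_eq_zero_of_not_mem_image p (.ge 1) (.ge 1) y hx, mul_zero]
    _ = ∑' y, ∑ ι : Fin d × Bool, kdc y 0 * L.T (.ge 1) (.eq 1) (.ge 1) (y + stepVec ι) y 0 := by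
        refine tsum_congr fun y => ?_
        rw [Finset.sum_image fun u _ v _ h => add_left_cancel h, sum_unitVecs]
    _ ≤ ∑' y, ∑ ι : Fin d × Bool, kdc y 0 * (ENNReal.ofReal p * L.B (.ge 1) (.ge 1) (-y) (stepVec ι)) := by
        refine ENNReal.tsum_le_tsum fun y => Finset.sum_le_sum fun ι _ => ?_
        simpa [add_sub_cancel_left] using hterm (y + stepVec ι) y
    _ = ENNReal.ofReal p * ∑ ι : Fin d × Bool, ∑' y, kdc y 0 * L.B (.ge 1) (.ge 1) (-y) (stepVec ι) := by
        rw [← Summable.tsum_finsetSum (fun _ _ => ENNReal.summable), ← ENNReal.tsum_mul_left]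
        refine tsum_congr fun y => ?_
        rw [Finset.mul_sum]
        exact Finset.sum_congr rfl fun ι _ => mul_left_comm _ _ _
    _ ≤ ENNReal.ofReal p * ∑ ι : Fin d × Bool, ENNReal.ofReal (bubbleSlotR p (nobleSup2 d p) 1 1 M N R₁ R₂) := by
        gcongr with ι
        exact hslot ι
    _ = ENNReal.ofReal (((2 * d : ℕ) : ℝ) * (p : ℝ) * bubbleSlotR p (nobleSup2 d p) 1 1 M N R₁ R₂) := by
        have h2dp : (0 : ℝ) ≤ ((2 * d : ℕ) : ℝ) * (p : ℝ) := mul_nonneg (Nat.cast_nonneg _) p.2.1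
        rw [Finset.sum_const, Finset.card_univ, Fintype.card_prod, Fintype.card_fin, Fintype.card_bool, nsmul_eq_mul,
          ENNReal.ofReal_mul h2dp, ENNReal.ofReal_mul (Nat.cast_nonneg _), ENNReal.ofReal_natCast]
        push_cast
        ring

/-- **`P^{E}_1` in tier P.**  `P^{E}_1 ≤ 2d · p · bubbleSlotR p Γ̄₂ 1 1 M N R₁ R₂` (drop the constraint `x ≠ 0` and
apply `perc_tsum_tsum_kdc_T_ge_eqOne_ge_le_peel`).
[cite: FitznerVanDerHofstad2017, App. B Table "P^b" row b = 1 (arXiv:1506.07977v2 p. 73); §5.1 Table "P^{E,b}" (p. 47); §6.1 after (6.4) (p. 58)] [cite: FitznerVanDerHofstad2016NoBLE, §5.2 (5.40) (arXiv:1506.07969)] -/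
theorem perc_vecPE_one_le_peel (hd : 2 ≤ d) (hp : p < criticalProbI d) {M : ℕ} (hM : 1 ≤ M) {N : ℕ → ℕ}
    (hN : ∀ L (ι : Fin d × Bool), (trailWordsTo d L (stepVec ι : Site d)).card ≤ N L) {R₁ R₂ : ℝ}
    (hR₁ : IsRemKernelConst d [M] (Set.range fun ι : Fin d × Bool => (stepVec ι : Site d)) R₁)
    (hR₂ : IsRemKernelConst d [M - 1, 1] (Set.range fun ι : Fin d × Bool => (stepVec ι : Site d)) R₂) :
    vecPE (Letters.perc d p) 1 ≤
      ENNReal.ofReal (((2 * d : ℕ) : ℝ) * (p : ℝ) * bubbleSlotR p (nobleSup2 d p) 1 1 M N R₁ R₂) := by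
  refine le_trans ?_ (perc_tsum_tsum_kdc_T_ge_eqOne_ge_le_peel p hd hp hM hN hR₁ hR₂)
  rw [vecPE_one]
  refine ENNReal.tsum_le_tsum fun x => ENNReal.tsum_le_tsum fun y => ?_
  calc kdc x 0 * kdc y 0 * (Letters.perc d p).T (.ge 1) (.eq 1) (.ge 1) x y 0
      ≤ 1 * kdc y 0 * (Letters.perc d p).T (.ge 1) (.eq 1) (.ge 1) x y 0 := by
        gcongr
        exact kdc_le_one x 0
    _ = _ := by rw [one_mul]

/-- **`A_{0,1}` in tier P.**  `A_{0,1} = Σ_x Σ_{y ≠ 0} 𝓣_{1,1̲,1}(x,y,0) ≤ 2d · p · bubbleSlotR p Γ̄₂ 1 1 M N R₁ R₂`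
(`matA_zero_one`; the same letter as `P^{E}_1` without the constraint `x ≠ 0`).
[cite: FitznerVanDerHofstad2017, App. B Table "definition of A^{a,b}(v,x,y)", row (0,1) (arXiv:1506.07977v2 p. 74); §5.1 "Elements of the bounds" (p. 49); §6.1 after (6.4) (p. 58)] [cite: FitznerVanDerHofstad2016NoBLE, §5.2 (5.40) (arXiv:1506.07969)] -/
theorem perc_matA_zero_one_le_peel (hd : 2 ≤ d) (hp : p < criticalProbI d) {M : ℕ} (hM : 1 ≤ M) {N : ℕ → ℕ}
    (hN : ∀ L (ι : Fin d × Bool), (trailWordsTo d L (stepVec ι : Site d)).card ≤ N L) {R₁ R₂ : ℝ}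
    (hR₁ : IsRemKernelConst d [M] (Set.range fun ι : Fin d × Bool => (stepVec ι : Site d)) R₁)
    (hR₂ : IsRemKernelConst d [M - 1, 1] (Set.range fun ι : Fin d × Bool => (stepVec ι : Site d)) R₂) :
    matA (Letters.perc d p) 0 1 ≤
      ENNReal.ofReal (((2 * d : ℕ) : ℝ) * (p : ℝ) * bubbleSlotR p (nobleSup2 d p) 1 1 M N R₁ R₂) := by
  rw [matA_zero_one]
  exact perc_tsum_tsum_kdc_T_ge_eqOne_ge_le_peel p hd hp hM hN hR₁ hR₂

/-- `P^{S}_1 = Σ_{x ≠ 0} 𝓑_{3,1̲}(x,0) + P^{E}_1` (App. B: the closed-loop term plus the triangle term).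
[cite: FitznerVanDerHofstad2017, App. B Table "definition of P^b(x,y)", row b = 1 (arXiv:1506.07977v2 p. 73); §5.1 "Elements of the bounds" (p. 49)] -/
theorem vecPS_one_eq_tsum_add_vecPE (L : Letters d) :
    vecPS L 1 = (∑' x, kdc x 0 * L.B (.ge 3) (.eq 1) x 0) + vecPE L 1 := by
  rw [vecPS_one, vecPE_one, ← ENNReal.tsum_add]
  refine tsum_congr fun x => ?_
  rw [mul_add, ← ENNReal.tsum_mul_left]
  congr 1
  exact tsum_congr fun y => (mul_assoc _ _ _).symm

/-- **The loop term of `P^{S}_1` peels LOSSLESSLY: `Σ_{x ≠ 0} 𝓑_{3,1̲}(x,0) ≤ p · Σ_ι τ_{≥3}(e_ι)`** (support `|x| = 1`,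
`perc_B_eqOne₂_le_p_mul_tau`; the notebook's `Bound[Loop,4,s] = 2d z[s] Bound[G,{1},3,s]`).
[cite: FitznerVanDerHofstad2017, App. B Table "definition of P^b(x,y)", row b = 1 (arXiv:1506.07977v2 p. 73); §4.2 (4.10), (4.16) (pp. 35–36); §6.1 after (6.4) (p. 58)] -/
theorem perc_tsum_kdc_B_ge_eqOne_le (m : ℕ) :
    ∑' x, kdc x 0 * (Letters.perc d p).B (.ge m) (.eq 1) x 0 ≤
      ENNReal.ofReal p * ∑ ι : Fin d × Bool, (Letters.perc d p).tau (.ge m) (stepVec ι) := by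
  classical
  calc ∑' x, kdc x 0 * (Letters.perc d p).B (.ge m) (.eq 1) x 0
      = ∑ x ∈ unitVecs d, kdc x 0 * (Letters.perc d p).B (.ge m) (.eq 1) x 0 := by
        refine tsum_eq_sum fun x hx => ?_
        rw [perc_B_eqOne₂_eq_zero p (.ge m) (by simpa using neg_not_mem_unitVecs hx), mul_zero]
    _ ≤ ∑ x ∈ unitVecs d, ENNReal.ofReal p * (Letters.perc d p).tau (.ge m) x := by
        refine Finset.sum_le_sum fun x _ => ?_
        calc kdc x 0 * (Letters.perc d p).B (.ge m) (.eq 1) x 0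
            ≤ 1 * (ENNReal.ofReal p * (Letters.perc d p).tau (.ge m) x) := by
              gcongr
              · exact kdc_le_one x 0
              · exact perc_B_eqOne₂_le_p_mul_tau p (.ge m) x 0
          _ = _ := one_mul _
    _ = ENNReal.ofReal p * ∑ ι : Fin d × Bool, (Letters.perc d p).tau (.ge m) (stepVec ι) := by
        rw [← Finset.mul_sum, sum_unitVecs]

/-- The loop term in the row-`N = 0` convention `τ_{≥m}(e_ι) = τ_{≥m}(e₁) ≤ T` (`tauGe_stepVec`, `perc_tau_ge`):
`Σ_{x ≠ 0} 𝓑_{m,1̲}(x,0) ≤ 2d · p · T`.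
[cite: FitznerVanDerHofstad2017, App. B Table "definition of P^b(x,y)", row b = 1 (arXiv:1506.07977v2 p. 73); §4.2 (4.1), (4.16) (pp. 34–36)] -/
theorem perc_tsum_kdc_B_ge_eqOne_le_ofReal (hd : 1 ≤ d) (m : ℕ) {T : ℝ} (hT : tauGe d p m (unitSite1 d) ≤ T) :
    ∑' x, kdc x 0 * (Letters.perc d p).B (.ge m) (.eq 1) x 0 ≤ ENNReal.ofReal (((2 * d : ℕ) : ℝ) * (p : ℝ) * T) := by
  refine (perc_tsum_kdc_B_ge_eqOne_le p m).trans ?_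
  have h1 : ∀ ι : Fin d × Bool, (Letters.perc d p).tau (.ge m) (stepVec ι) ≤ ENNReal.ofReal T := by
    intro ι
    rw [perc_tau_ge, tauGe_stepVec hd p m ι]
    exact ENNReal.ofReal_le_ofReal hT
  have h2dp : (0 : ℝ) ≤ ((2 * d : ℕ) : ℝ) * (p : ℝ) := mul_nonneg (Nat.cast_nonneg _) p.2.1
  calc ENNReal.ofReal p * ∑ ι : Fin d × Bool, (Letters.perc d p).tau (.ge m) (stepVec ι)
      ≤ ENNReal.ofReal p * ∑ _ι : Fin d × Bool, ENNReal.ofReal T := by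
        gcongr with ι
        exact h1 ι
    _ = ENNReal.ofReal (((2 * d : ℕ) : ℝ) * (p : ℝ) * T) := by
        rw [Finset.sum_const, Finset.card_univ, Fintype.card_prod, Fintype.card_fin, Fintype.card_bool, nsmul_eq_mul,
          ENNReal.ofReal_mul h2dp, ENNReal.ofReal_mul (Nat.cast_nonneg _), ENNReal.ofReal_natCast]
        push_cast
        ring

/-- **`P^{S}_1` from ANY real majorant `W` of `P^{E}_1`** (the consumer shape `vecPS … ≤ ofReal (uR 1)` of the packet's
component-majorant interface): `P^{S}_1 ≤ 2d·p·T3 + W` for `τ_{≥3}(e₁) ≤ T3`, `0 ≤ W`, `P^{E}_1 ≤ W`.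
[cite: FitznerVanDerHofstad2017, App. B Table "definition of P^b(x,y)", row b = 1 (arXiv:1506.07977v2 p. 73); §4.2 (4.16) (p. 36)] -/
theorem perc_vecPS_one_le_ofReal_of_vecPE (hd : 1 ≤ d) {T3 : ℝ} (h3 : tauGe d p 3 (unitSite1 d) ≤ T3) {W : ℝ}
    (hW0 : 0 ≤ W) (hW : vecPE (Letters.perc d p) 1 ≤ ENNReal.ofReal W) :
    vecPS (Letters.perc d p) 1 ≤ ENNReal.ofReal (((2 * d : ℕ) : ℝ) * (p : ℝ) * T3 + W) := by
  have hT3 : (0 : ℝ) ≤ ((2 * d : ℕ) : ℝ) * (p : ℝ) * T3 :=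
    mul_nonneg (mul_nonneg (Nat.cast_nonneg _) p.2.1) ((tauGe_nonneg p 3 _).trans h3)
  rw [vecPS_one_eq_tsum_add_vecPE, ENNReal.ofReal_add hT3 hW0]
  exact add_le_add (perc_tsum_kdc_B_ge_eqOne_le_ofReal p hd 3 h3) hW

/-- **PS[1] in tier P: `P^{S}_1 ≤ p · Σ_ι τ_{≥3}(e_ι) + 2d · p · (5.40)-slot_{1,1} on the unit classes`**
(loop term lossless, triangle term `perc_vecPE_one_le_peel`).
[cite: FitznerVanDerHofstad2017, App. B Table "definition of P^b(x,y)", row b = 1 (arXiv:1506.07977v2 p. 73); §4.2 (4.10), (4.16)–(4.17) (pp. 35–36); §6.1 after (6.4) (p. 58)]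
[cite: FitznerVanDerHofstad2016NoBLE, §5.3.2 (5.40) (PTRF 169 (2017) p. 1098)] -/
theorem perc_vecPS_one_le_peel (hd : 2 ≤ d) (hp : p < criticalProbI d) {M : ℕ} (hM : 1 ≤ M) {N : ℕ → ℕ}
    (hN : ∀ L (ι : Fin d × Bool), (trailWordsTo d L (stepVec ι : Site d)).card ≤ N L) {R₁ R₂ : ℝ}
    (hR₁ : IsRemKernelConst d [M] (Set.range fun ι : Fin d × Bool => (stepVec ι : Site d)) R₁)
    (hR₂ : IsRemKernelConst d [M - 1, 1] (Set.range fun ι : Fin d × Bool => (stepVec ι : Site d)) R₂) :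
    vecPS (Letters.perc d p) 1 ≤
      ENNReal.ofReal p * (∑ ι : Fin d × Bool, (Letters.perc d p).tau (.ge 3) (stepVec ι)) +
        ENNReal.ofReal (((2 * d : ℕ) : ℝ) * (p : ℝ) * bubbleSlotR p (nobleSup2 d p) 1 1 M N R₁ R₂) := by
  rw [vecPS_one_eq_tsum_add_vecPE]
  exact add_le_add (perc_tsum_kdc_B_ge_eqOne_le p 3) (perc_vecPE_one_le_peel p hd hp hM hN hR₁ hR₂)

/-- **PS[1] in tier P, consumer shape**: `P^{S}_1 ≤ 2d·p·(T3 + (5.40)-slot_{1,1})` for `τ_{≥3}(e₁) ≤ T3` and a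
non-negative slot value (`bubbleSlotR_nonneg`).
[cite: FitznerVanDerHofstad2017, App. B Table "definition of P^b(x,y)", row b = 1 (arXiv:1506.07977v2 p. 73); §4.2 (4.1), (4.16)–(4.17) (pp. 34–36)]
[cite: FitznerVanDerHofstad2016NoBLE, §5.3.2 (5.40) (PTRF 169 (2017) p. 1098)] -/
theorem perc_vecPS_one_le_peel_ofReal (hd : 2 ≤ d) (hp : p < criticalProbI d) {M : ℕ} (hM : 1 ≤ M) {N : ℕ → ℕ}
    (hN : ∀ L (ι : Fin d × Bool), (trailWordsTo d L (stepVec ι : Site d)).card ≤ N L) {R₁ R₂ : ℝ}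
    (hR₁ : IsRemKernelConst d [M] (Set.range fun ι : Fin d × Bool => (stepVec ι : Site d)) R₁)
    (hR₂ : IsRemKernelConst d [M - 1, 1] (Set.range fun ι : Fin d × Bool => (stepVec ι : Site d)) R₂)
    {T3 : ℝ} (h3 : tauGe d p 3 (unitSite1 d) ≤ T3) (hS0 : 0 ≤ bubbleSlotR p (nobleSup2 d p) 1 1 M N R₁ R₂) :
    vecPS (Letters.perc d p) 1 ≤
      ENNReal.ofReal (((2 * d : ℕ) : ℝ) * (p : ℝ) * (T3 + bubbleSlotR p (nobleSup2 d p) 1 1 M N R₁ R₂)) := by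
  have h := perc_vecPS_one_le_ofReal_of_vecPE p (by omega) h3
    (mul_nonneg (mul_nonneg (Nat.cast_nonneg _) p.2.1) hS0) (perc_vecPE_one_le_peel p hd hp hM hN hR₁ hR₂)
  simpa [mul_add] using h

end EntryOne

/-! ## Peel at the third position (the exact CLOSING leg, `B^{(2),ι}` cells of node N76-EXL) -/

section PeelThird

variable (p : unitInterval)

/-- Set level, third line exact: on a labelled disjoint occurrence of `(0 ←j₁→ x, x ←j₂→ y, y ←1̲→ v)` the bond
`(y,v)` is open on the level of the exact line, and after closing it there the first two lines still occur
disjointly (they avoid the bond by disjointness of the witnesses).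
[cite: FitznerVanDerHofstad2017, §4.2 (4.16)–(4.17) (arXiv:1506.07977v2 p. 36); §4.4 (4.65) (p. 43)] -/
theorem genDisjOcc_lineEvents₃_eqOne₃_subset (j₁ j₂ : LenIdx) (x y v : Site d) (c : Fin 3 → Fin 3) :
    genDisjOcc (lineEvents₃ j₁ j₂ (.eq 1) x y v) c ⊆
      {ω | s(y, v) ∈ ω (c 2)} ∩
        eraseAt (c 2) s(y, v) ⁻¹' genDisjOcc ![event j₁ 0 x, event j₂ x y] ![c 0, c 1] := by
  rintro ω ⟨K, hKω, hKA, hd⟩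
  have h2 : K 2 ∈ (openConnEq 1 y v : Set (BondConfig (Site d))) := by
    simpa [lineEvents₃] using hKA 2
  obtain ⟨-, he⟩ := (mem_openConnEq_one_iff y v (K 2)).1 h2
  have he0 : s(y, v) ∉ K 0 := fun h => Set.disjoint_left.1 (hd (show (0 : Fin 3) ≠ 2 by decide)) h he
  have he1 : s(y, v) ∉ K 1 := fun h => Set.disjoint_left.1 (hd (show (1 : Fin 3) ≠ 2 by decide)) h he
  have hsurv : ∀ {l : Fin 3} {S : Set (Sym2 (Site d))}, S ⊆ ω l → s(y, v) ∉ S →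
      S ⊆ eraseAt (c 2) s(y, v) ω l := by
    intro l S hS hnot
    by_cases hl : l = c 2
    · rw [hl, eraseAt_apply_same]
      intro b hb
      exact ⟨hl ▸ hS hb, fun hbe => hnot (by rwa [Set.mem_singleton_iff.1 hbe] at hb)⟩
    · rw [eraseAt_apply_ne hl]; exact hS
  refine ⟨hKω 2 he, ?_⟩
  refine ⟨![K 0, K 1], ?_, ?_, ?_⟩
  · intro j
    fin_cases j
    · exact hsurv (hKω 0) he0
    · exact hsurv (hKω 1) he1
  · intro j
    fin_cases j
    · simpa [lineEvents₃] using hKA 0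
    · simpa [lineEvents₃] using hKA 1
  · intro i j hij
    fin_cases i <;> fin_cases j
    · exact absurd rfl hij
    · exact hd (show (0 : Fin 3) ≠ 1 by decide)
    · exact hd (show (1 : Fin 3) ≠ 0 by decide)
    · exact absurd rfl hij

/-- `𝓣_{j₁,j₂,1̲}(x,y,v) = 0` if `v − y ∉ unitVecs d` (its third line is `{y ←1̲→ v}`).
[cite: FitznerVanDerHofstad2017, §4.2 (4.17) (arXiv:1506.07977v2 p. 36)] -/
theorem perc_T_eqOne₃_eq_zero (j₁ j₂ : LenIdx) (x : Site d) {y v : Site d} (h : v - y ∉ unitVecs d) :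
    (Letters.perc d p).T j₁ j₂ (.eq 1) x y v = 0 := by
  rw [perc_T]
  exact repLetter_eq_zero_of_null p _ 2 (isUpperSet_event (.eq 1) y v) (perc_event_eqOne_eq_zero p h)

/-- **EXL-PEEL-THIRD.  `𝓣_{j₁,j₂,1̲}(x,y,v) ≤ p · 𝓑_{j₁,j₂}(x,y)`**: the repulsive triangle whose third (closing) line
is the exact unit leg `{y ←1̲→ v}` is at most `p` times the repulsive bubble of its first two lines `0 → x → y`
(no re-rooting needed; it vanishes unless `v − y` is a unit vector).  This is the device for the small triangles
`𝓣_{1,1,1̲}(·,·,0)` of the `B^{(2),ι}` cells.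
[cite: FitznerVanDerHofstad2017, §4.2 (4.16)–(4.17) (arXiv:1506.07977v2 p. 36); §4.4 (4.65), §6.1 after (6.4) (pp. 43, 58); App. B Table "B^{(2),ι}" (p. 77)] -/
theorem perc_T_eqOne₃_le_p_mul_B (j₁ j₂ : LenIdx) (x y v : Site d) :
    (Letters.perc d p).T j₁ j₂ (.eq 1) x y v ≤ ENNReal.ofReal p * (Letters.perc d p).B j₁ j₂ x y := by
  classical
  by_cases hyv : v - y ∈ unitVecs d
  · have he := mem_edgeSet_of_sub_mem_unitVecs hyv
    rw [perc_T, repLetter]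
    refine Finset.sup_le fun c _ => ?_
    calc piPerc d p 3 (genDisjOcc (lineEvents₃ j₁ j₂ (.eq 1) x y v) c)
        ≤ ENNReal.ofReal p * piPerc d p 3 (genDisjOcc ![event j₁ 0 x, event j₂ x y] ![c 0, c 1]) :=
          piPerc_le_p_mul_of_subset_bond p (c 2) he (fun l => by fin_cases l <;> exact isFinitary_event _ _ _)
            ![c 0, c 1] (genDisjOcc_lineEvents₃_eqOne₃_subset j₁ j₂ x y v c)
      _ ≤ ENNReal.ofReal p * (Letters.perc d p).B j₁ j₂ x y := by
          gcongr
          simpa using piPerc_genDisjOcc_le_B p j₁ j₂ 0 x y ![c 0, c 1]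
  · rw [perc_T_eqOne₃_eq_zero p j₁ j₂ x hyv]
    exact bot_le

/-- Node form for the `B^{(2),ι}` cells: `𝓣_{m₁,m₂,1̲}(x,y,0) ≤ p · 𝓑_{m₁,m₂}(x,y)`.
[cite: FitznerVanDerHofstad2017, App. B Table "B^{(2),ι}" (arXiv:1506.07977v2 p. 77); §4.2 (4.16)–(4.17) (p. 36)] -/
theorem perc_T_ge_ge_eqOne_le_p_mul_B (m₁ m₂ : ℕ) (x y : Site d) :
    (Letters.perc d p).T (.ge m₁) (.ge m₂) (.eq 1) x y 0 ≤
      ENNReal.ofReal p * (Letters.perc d p).B (.ge m₁) (.ge m₂) x y :=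
  perc_T_eqOne₃_le_p_mul_B p (.ge m₁) (.ge m₂) x y 0

end PeelThird

/-! ## The primed row `(0,0)`: `(Ā^{ι}')_{0,0}`, `(Ā^{ι,*}')_{0,0}` in tier P (PEEL-FIRST + unit-endpoint slot) -/

section AbarIotaPrimeZeroZero

variable (p : unitInterval)

/-- **The §6.1 letter sum of the primed row `(0,0)` by the peel.**
`Σ_x Σ_κ (1−δ_{0,x})(1−δ_{x,e_κ}) 𝓣_{1̲,1,1}(e_κ,x,0) ≤ 2d · p · slot`: peel the exact FIRST leg `{0 ←1̲→ e_κ}`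
(`perc_T_eqOne₁_le_p_mul_B`: factor `p`, bubble `𝓑_{1,1}(x − e_κ, −e_κ)` re-rooted at `e_κ`, endpoint the unit
vector `−e_κ`), re-index `y = x − e_κ` (`(1−δ_{x,e_κ}) = (1−δ_{y,0})`) and price each of the `2d` unit-endpoint
slots by [NoBLE17] (5.40) (`tsum_kdc_perc_B_ge_le_ofReal`).  The SAME real majorant as for `P^{E}_1`.
[cite: FitznerVanDerHofstad2017, §6.1 Case a = 0, b = 0 and after (6.4) (arXiv:1506.07977v2 pp. 58–59); §4.2 (4.16)–(4.17) (p. 36)] [cite: FitznerVanDerHofstad2016NoBLE, §5.2 (5.40) (arXiv:1506.07969)] -/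
theorem perc_tsum_sum_kdc_T_eqOne_ge_ge_stepVec_le_peel (hd : 2 ≤ d) (hp : p < criticalProbI d) {M : ℕ}
    (hM : 1 ≤ M) {N : ℕ → ℕ} (hN : ∀ L (ι : Fin d × Bool), (trailWordsTo d L (stepVec ι : Site d)).card ≤ N L)
    {R₁ R₂ : ℝ} (hR₁ : IsRemKernelConst d [M] (Set.range fun ι : Fin d × Bool => (stepVec ι : Site d)) R₁)
    (hR₂ : IsRemKernelConst d [M - 1, 1] (Set.range fun ι : Fin d × Bool => (stepVec ι : Site d)) R₂) :
    ∑' x, ∑ κ : Fin d × Bool, kdc 0 x * kdc x (stepVec κ) *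
        (Letters.perc d p).T (.eq 1) (.ge 1) (.ge 1) (stepVec κ) x 0 ≤
      ENNReal.ofReal (((2 * d : ℕ) : ℝ) * (p : ℝ) * bubbleSlotR p (nobleSup2 d p) 1 1 M N R₁ R₂) := by
  classical
  set L := Letters.perc d p with hL
  -- the unit-endpoint slot at `-e_κ = e_{srev κ}`
  have hslot : ∀ κ : Fin d × Bool,
      ∑' y, kdc y 0 * L.B (.ge 1) (.ge 1) y (-(stepVec κ : Site d)) ≤
        ENNReal.ofReal (bubbleSlotR p (nobleSup2 d p) 1 1 M N R₁ R₂) := by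
    intro κ
    have hmem : (-(stepVec κ : Site d)) ∈ Set.range fun ι : Fin d × Bool => (stepVec ι : Site d) :=
      ⟨srev κ, by simp⟩
    exact tsum_kdc_perc_B_ge_le_ofReal hd p hp hM hmem (fun K => by simpa using hN K (srev κ)) hR₁ hR₂
  -- the summand: drop `(1−δ_{0,x})`, peel the first leg
  have hterm : ∀ (κ : Fin d × Bool) (x : Site d),
      kdc 0 x * kdc x (stepVec κ) * L.T (.eq 1) (.ge 1) (.ge 1) (stepVec κ) x 0 ≤
        kdc x (stepVec κ) * (ENNReal.ofReal p * L.B (.ge 1) (.ge 1) (x - stepVec κ) (-(stepVec κ : Site d))) := by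
    intro κ x
    calc kdc 0 x * kdc x (stepVec κ) * L.T (.eq 1) (.ge 1) (.ge 1) (stepVec κ) x 0
        ≤ 1 * kdc x (stepVec κ) *
            (ENNReal.ofReal p * L.B (.ge 1) (.ge 1) (x - stepVec κ) (0 - (stepVec κ : Site d))) := by
          gcongr
          · exact kdc_le_one 0 x
          · exact perc_T_eqOne₁_le_p_mul_B p (.ge 1) (.ge 1) (stepVec κ) x 0
      _ = _ := by rw [one_mul, zero_sub]
  -- re-index each `κ`-slice by `y = x - e_κ`
  have hre : ∀ κ : Fin d × Bool,
      ∑' x, kdc x (stepVec κ) * L.B (.ge 1) (.ge 1) (x - stepVec κ) (-(stepVec κ : Site d)) =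
        ∑' y, kdc y 0 * L.B (.ge 1) (.ge 1) y (-(stepVec κ : Site d)) := by
    intro κ
    rw [← (Equiv.subRight (stepVec κ : Site d)).tsum_eq
      (fun y => kdc y 0 * L.B (.ge 1) (.ge 1) y (-(stepVec κ : Site d)))]
    refine tsum_congr fun x => ?_
    simp [kdc, sub_eq_zero]
  calc ∑' x, ∑ κ : Fin d × Bool, kdc 0 x * kdc x (stepVec κ) * L.T (.eq 1) (.ge 1) (.ge 1) (stepVec κ) x 0
      ≤ ∑' x, ∑ κ : Fin d × Bool,
          kdc x (stepVec κ) * (ENNReal.ofReal p * L.B (.ge 1) (.ge 1) (x - stepVec κ) (-(stepVec κ : Site d))) :=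
        ENNReal.tsum_le_tsum fun x => Finset.sum_le_sum fun κ _ => hterm κ x
    _ = ENNReal.ofReal p * ∑ κ : Fin d × Bool,
          ∑' x, kdc x (stepVec κ) * L.B (.ge 1) (.ge 1) (x - stepVec κ) (-(stepVec κ : Site d)) := by
        rw [← Summable.tsum_finsetSum (fun _ _ => ENNReal.summable), ← ENNReal.tsum_mul_left]
        refine tsum_congr fun x => ?_
        rw [Finset.mul_sum]
        exact Finset.sum_congr rfl fun κ _ => mul_left_comm _ _ _
    _ = ENNReal.ofReal p * ∑ κ : Fin d × Bool, ∑' y, kdc y 0 * L.B (.ge 1) (.ge 1) y (-(stepVec κ : Site d)) := by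
        congr 1
        exact Finset.sum_congr rfl fun κ _ => hre κ
    _ ≤ ENNReal.ofReal p * ∑ κ : Fin d × Bool, ENNReal.ofReal (bubbleSlotR p (nobleSup2 d p) 1 1 M N R₁ R₂) := by
        gcongr with κ
        exact hslot κ
    _ = ENNReal.ofReal (((2 * d : ℕ) : ℝ) * (p : ℝ) * bubbleSlotR p (nobleSup2 d p) 1 1 M N R₁ R₂) := by
        have h2dp : (0 : ℝ) ≤ ((2 * d : ℕ) : ℝ) * (p : ℝ) := mul_nonneg (Nat.cast_nonneg _) p.2.1
        rw [Finset.sum_const, Finset.card_univ, Fintype.card_prod, Fintype.card_fin, Fintype.card_bool, nsmul_eq_mul,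
          ENNReal.ofReal_mul h2dp, ENNReal.ofReal_mul (Nat.cast_nonneg _), ENNReal.ofReal_natCast]
        push_cast
        ring

/-- **`(Ā^{ι}')_{0,0}` in tier P** (the element the `N ≥ 1` chain carries, `NobleBoundsNAssembly`):
`(Ā^{ι}')_{0,0} ≤ 2d · p · bubbleSlotR p Γ̄₂ 1 1 M N R₁ R₂` (`matAbarIota'_zero_zero` + the peel of the first leg).
[cite: FitznerVanDerHofstad2017, §6.1 Case a = 0, b = 0 (arXiv:1506.07977v2 p. 59); §5.1 "Elements of the bounds" (p. 49); §6.1 after (6.4) (p. 58)] [cite: FitznerVanDerHofstad2016NoBLE, §5.2 (5.40) (arXiv:1506.07969)] -/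
theorem perc_matAbarIota'_zero_zero_le_peel (hd : 2 ≤ d) (hp : p < criticalProbI d) {M : ℕ} (hM : 1 ≤ M)
    {N : ℕ → ℕ} (hN : ∀ L (ι : Fin d × Bool), (trailWordsTo d L (stepVec ι : Site d)).card ≤ N L) {R₁ R₂ : ℝ}
    (hR₁ : IsRemKernelConst d [M] (Set.range fun ι : Fin d × Bool => (stepVec ι : Site d)) R₁)
    (hR₂ : IsRemKernelConst d [M - 1, 1] (Set.range fun ι : Fin d × Bool => (stepVec ι : Site d)) R₂) :
    matAbarIota' (Letters.perc d p) 0 0 ≤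
      ENNReal.ofReal (((2 * d : ℕ) : ℝ) * (p : ℝ) * bubbleSlotR p (nobleSup2 d p) 1 1 M N R₁ R₂) := by
  rw [matAbarIota'_zero_zero]
  exact perc_tsum_sum_kdc_T_eqOne_ge_ge_stepVec_le_peel p hd hp hM hN hR₁ hR₂

/-- **`(Ā^{ι,*}')_{0,0}` in tier P**: the primed non-repulsive twin has the same closed form
(`matAbarIotaSt'_zero_zero`), hence the same majorant.
[cite: FitznerVanDerHofstad2017, §6.1 Case a = 0, b = 0 (arXiv:1506.07977v2 p. 59); §5.1 (pp. 47, 49)] [cite: FitznerVanDerHofstad2016NoBLE, §5.2 (5.40) (arXiv:1506.07969)] -/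
theorem perc_matAbarIotaSt'_zero_zero_le_peel (hd : 2 ≤ d) (hp : p < criticalProbI d) {M : ℕ} (hM : 1 ≤ M)
    {N : ℕ → ℕ} (hN : ∀ L (ι : Fin d × Bool), (trailWordsTo d L (stepVec ι : Site d)).card ≤ N L) {R₁ R₂ : ℝ}
    (hR₁ : IsRemKernelConst d [M] (Set.range fun ι : Fin d × Bool => (stepVec ι : Site d)) R₁)
    (hR₂ : IsRemKernelConst d [M - 1, 1] (Set.range fun ι : Fin d × Bool => (stepVec ι : Site d)) R₂) :
    matAbarIotaSt' (Letters.perc d p) 0 0 ≤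
      ENNReal.ofReal (((2 * d : ℕ) : ℝ) * (p : ℝ) * bubbleSlotR p (nobleSup2 d p) 1 1 M N R₁ R₂) := by
  rw [matAbarIotaSt'_zero_zero]
  exact perc_tsum_sum_kdc_T_eqOne_ge_ge_stepVec_le_peel p hd hp hM hN hR₁ hR₂

end AbarIotaPrimeZeroZero



end Literature.Probability.FitznerVanDerHofstad2017.NobleBlocks

end
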